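import Mathlib.GroupTheory.SpecificGroups.Dihedral
import Mathlib.Algebra.Group.Subgroup.Finite
import Mathlib.GroupTheory.Index
import Mathlib.Data.ZMod.QuotientGroup
import Literature.Combinatorics.Additive.TripleProductProperty
import HarnessLib

/-!
# Cohn–Umans 2003, Prop. 18 (arXiv numbering), second clause: no three subgroups prove `α(D_p) < 3`

Topic `Literature/Computability/AlgebraicComplexity` (group-theoretic matrix multiplication), namespace
`Literature.Computability.AlgebraicComplexity.DihedralSubgroups`.

H. Cohn, C. Umans, *A group-theoretic approach to fast matrix multiplication*, FOCS 2003 = arXiv:math/0307321, §7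
"Direct products and the Sperner capacity" (arXiv p. 10), verbatim:

> "We will be led for the first time since Lemma 2.2 to realize matrix multiplication through quotient sets that
> are not subgroups. Proposition 18 below proves that this complication is necessary to determine the
> pseudo-exponents of certain groups. Let `D_m` be the dihedral group generated by `x` and `y`, with the relations
> `y² = xᵐ = 1` and `yxy = x⁻¹`.
> **Proposition 18.** For every `m`, `D_m` realizes `⟨2, 2, 2⌊m/3⌋⟩`, and hence `α(D_m) < 3` for `m ≥ 9`. If `m` is
> a prime greater than `3`, then no three subgroups prove `α(D_m) < 3`.
> *Proof.* […] When `m` is prime, all subgroups of `D_m` have order `1`, `2`, `m`, or `2m`, and it is easy to rule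
> out each case (except when `m = 3`, in which case three subgroups of order `2` prove `α(D_3) < 3`)."

("Three subgroups `H₁, H₂, H₃` prove `α(G) < 3`" = they satisfy the triple product property — for subgroups:
`h₁h₂h₃ = 1`, `hᵢ ∈ Hᵢ` forces `h₁ = h₂ = h₃ = 1`, CU03 Def. 2.1 with `Q(Hᵢ) = Hᵢ` — and `|H₁||H₂||H₃| > |G|`,
Def. 2.2 / Lemma 3.1.)  The first clause (the realization of `⟨2, 2, 2⌊m/3⌋⟩` through the non-subgroup `S₃`) is
the census family `Summit.MatrixMultiplication.OmegaCensus.dihedral_family_tpp` and is not repeated here.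

## What is here (all proved, 0 named facts)

For a prime `p > 3` and subgroups `H₁, H₂, H₃ ≤ D_{2p}` (Mathlib `DihedralGroup p`, `x = r 1`, `y = sr 0`)
satisfying the subgroup triple product property (`SubgroupTPP`):
**`CohnUmans2003_prop18_subgroups : |H₁| · |H₂| · |H₃| ≤ 2p = |D_{2p}|`**, i.e. no three subgroups prove
`α(D_p) < 3`; and the same with the hypothesis stated through the tree's `TripleProductProperty` on the three
underlying finite sets (`CohnUmans2003_prop18_subgroups'`).

Proof ("easy to rule out each case", spelled out): the orders divide `2p`, so lie in `{1, 2, p, 2p}`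
(`card_subgroup_mem`); the TPP makes the three subgroups pairwise disjoint (`SubgroupTPP.eq_one_of_mem_*`), so an
`Hᵢ = D_{2p}` forces the other two to be trivial and two subgroups of order `p` are impossible (both are the
rotation subgroup `⟨x⟩`, `rotation_mem_of_card_eq`); a subgroup of order `2` is `{1, yxⁱ}` (`reflection_mem_of_card_eq_two`),
and the only order pattern with product `> 2p` left, `{2, 2, p}`, is killed in each of its three arrangements by
the identity `(yxⁱ)(yxʲ) = xʲ⁻ⁱ ∈ ⟨x⟩` (`no_two_two_p`, `no_two_p_two`, `no_p_two_two`); `2·2·2 = 8 ≤ 2p` as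
`p ≥ 5` (for `p = 3` three subgroups of order `2` do work, as printed).

## References
* H. Cohn, C. Umans, FOCS 2003, 438–449; arXiv:math/0307321, §7, Prop. 18 of the arXiv text (p. 10), Def. 2.1,
  Def. 2.2, Lemma 3.1. [CohnUmans2003]
-/

namespace Literature.Computability.AlgebraicComplexity

namespace DihedralSubgroups

open Finset DihedralGroup Literature.Combinatorics.Additive

variable {G : Type*} [Group G]

/-- **Three subgroups satisfying the triple product property** (CU03 Def. 2.1 for subgroups, where `Q(H) = H`):
`h₁ h₂ h₃ = 1` with `hᵢ ∈ Hᵢ` only for `h₁ = h₂ = h₃ = 1`. [cite: CohnUmans2003, Def. 2.1 (remark: "if the Sᵢ are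
subgroups … the condition simplifies")] -/
def SubgroupTPP (H₁ H₂ H₃ : Subgroup G) : Prop :=
  ∀ a ∈ H₁, ∀ b ∈ H₂, ∀ c ∈ H₃, a * b * c = 1 → a = 1 ∧ b = 1 ∧ c = 1

/-- The tree's (right-quotient) triple product property of the three underlying finite sets implies the subgroup
form (take `s' = t' = u' = 1`). [cite: CohnUmans2003, Def. 2.1 (remark after it)] -/
theorem subgroupTPP_of_tripleProductProperty [Fintype G] [DecidableEq G] (H₁ H₂ H₃ : Subgroup G)
    [DecidablePred (· ∈ H₁)] [DecidablePred (· ∈ H₂)] [DecidablePred (· ∈ H₃)]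
    (h : TripleProductProperty (univ.filter (· ∈ H₁)) (univ.filter (· ∈ H₂)) (univ.filter (· ∈ H₃))) :
    SubgroupTPP H₁ H₂ H₃ := by
  intro a ha b hb c hc habc
  have h1 : ∀ (H : Subgroup G) [DecidablePred (· ∈ H)] (x : G), x ∈ H → x ∈ univ.filter (· ∈ H) :=
    fun H _ x hx => by simpa using hx
  have := h a (h1 H₁ a ha) 1 (h1 H₁ 1 H₁.one_mem) b (h1 H₂ b hb) 1 (h1 H₂ 1 H₂.one_mem) c (h1 H₃ c hc)
    1 (h1 H₃ 1 H₃.one_mem) (by simpa using habc)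
  simpa using this

namespace SubgroupTPP

variable {H₁ H₂ H₃ : Subgroup G}

/-- TPP subgroups are pairwise disjoint: `H₁ ∩ H₂ = 1` (take `(x, x⁻¹, 1)`). [cite: CohnUmans2003, Prop. 18 (proof: "easy to rule out each case")] -/
theorem eq_one_of_mem₁₂ (h : SubgroupTPP H₁ H₂ H₃) {x : G} (h1 : x ∈ H₁) (h2 : x ∈ H₂) : x = 1 :=
  (h x h1 x⁻¹ (H₂.inv_mem h2) 1 H₃.one_mem (by group)).1

/-- `H₁ ∩ H₃ = 1` (take `(x, 1, x⁻¹)`). [cite: CohnUmans2003, Prop. 18 (proof)] -/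
theorem eq_one_of_mem₁₃ (h : SubgroupTPP H₁ H₂ H₃) {x : G} (h1 : x ∈ H₁) (h3 : x ∈ H₃) : x = 1 :=
  (h x h1 1 H₂.one_mem x⁻¹ (H₃.inv_mem h3) (by group)).1

/-- `H₂ ∩ H₃ = 1` (take `(1, x, x⁻¹)`). [cite: CohnUmans2003, Prop. 18 (proof)] -/
theorem eq_one_of_mem₂₃ (h : SubgroupTPP H₁ H₂ H₃) {x : G} (h2 : x ∈ H₂) (h3 : x ∈ H₃) : x = 1 :=
  (h 1 H₁.one_mem x h2 x⁻¹ (H₃.inv_mem h3) (by group)).2.1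

end SubgroupTPP

/-! ### Subgroups of `D_{2p}`, `p` prime -/

section Dihedral

variable {p : ℕ} [hp : Fact p.Prime]

/-- A divisor of `2p` is `1, 2, p` or `2p` ("all subgroups of `D_m` have order `1, 2, m, or 2m`").
[cite: CohnUmans2003, Prop. 18 (proof)] -/
theorem eq_of_dvd_two_mul_prime {d : ℕ} (hd : d ∣ 2 * p) : d = 1 ∨ d = 2 ∨ d = p ∨ d = 2 * p := by
  have hp' := hp.out
  by_cases hpd : p ∣ d
  · obtain ⟨e, rfl⟩ := hpd
    have he : e ∣ 2 := by
      have : p * e ∣ p * 2 := by rwa [mul_comm p 2]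
      exact (Nat.mul_dvd_mul_iff_left hp'.pos).mp this
    rcases (Nat.dvd_prime Nat.prime_two).mp he with rfl | rfl
    · exact Or.inr (Or.inr (Or.inl (mul_one p)))
    · exact Or.inr (Or.inr (Or.inr (mul_comm p 2)))
  · have hcop : Nat.Coprime d p := (Nat.Prime.coprime_iff_not_dvd hp').mpr hpd |>.symm
    have h2 : d ∣ 2 := hcop.dvd_of_dvd_mul_right hd
    rcases (Nat.dvd_prime Nat.prime_two).mp h2 with rfl | rfl
    · exact Or.inl rfl
    · exact Or.inr (Or.inl rfl)

/-- The order of a subgroup of `D_{2p}` is `1, 2, p` or `2p`. [cite: CohnUmans2003, Prop. 18 (proof: "all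
subgroups of D_m have order 1, 2, m, or 2m")] -/
theorem card_subgroup_mem (H : Subgroup (DihedralGroup p)) :
    Nat.card H = 1 ∨ Nat.card H = 2 ∨ Nat.card H = p ∨ Nat.card H = 2 * p :=
  eq_of_dvd_two_mul_prime (by rw [← DihedralGroup.nat_card (n := p)]; exact H.card_subgroup_dvd_card)

omit hp in
/-- `yxⁱ ≠ 1`. [folklore] -/
private theorem sr_ne_one (i : ZMod p) : (sr i : DihedralGroup p) ≠ 1 := by
  rw [one_def]; intro h; cases h

/-- A subgroup of `D_{2p}` of order `2` (`p` an odd prime) contains a reflection `yxⁱ`.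
[cite: CohnUmans2003, Prop. 18 (proof)] -/
theorem reflection_mem_of_card_eq_two (hp3 : 3 < p) {H : Subgroup (DihedralGroup p)} (hH : Nat.card H = 2) :
    ∃ i : ZMod p, sr i ∈ H := by
  have hne : H ≠ ⊥ := fun h => by rw [h, Subgroup.card_bot] at hH; exact absurd hH (by norm_num)
  obtain ⟨⟨x, hx⟩, hx1⟩ := (Subgroup.ne_bot_iff_exists_ne_one).mp hne
  have hx1' : x ≠ 1 := fun h => hx1 (Subtype.ext h)
  -- `x² = 1`
  have hsq : x ^ 2 = 1 := by
    have := pow_card_eq_one' (G := H) (x := ⟨x, hx⟩)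
    rw [hH] at this
    exact congrArg Subtype.val this
  cases x with
  | r i =>
    -- `xⁱ` with `x²ⁱ = 1`: `2i = 0` in `ℤ/p`, `p` odd, so `i = 0`
    exfalso
    rw [pow_two, r_mul_r, one_def] at hsq
    have h2i : i + i = 0 := r.inj hsq
    have h2 : (2 : ZMod p) * i = 0 := by rw [two_mul]; exact h2i
    have hcop : Nat.Coprime 2 p := (Nat.coprime_primes Nat.prime_two hp.out).mpr (by omega)
    have hi : i = 0 := (ZMod.unitOfCoprime 2 hcop).mul_right_eq_zero.mp
      (by rw [ZMod.coe_unitOfCoprime, Nat.cast_ofNat]; exact h2)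
    exact hx1' (by rw [hi, one_def])
  | sr i => exact ⟨i, hx⟩

/-- A subgroup of `D_{2p}` of order `p` (`p` an odd prime) is the rotation subgroup `⟨x⟩`: it contains every `xᵏ`.
[cite: CohnUmans2003, Prop. 18 (proof)] -/
theorem rotation_mem_of_card_eq (hp3 : 3 < p) {H : Subgroup (DihedralGroup p)} (hH : Nat.card H = p)
    (k : ZMod p) : r k ∈ H := by
  have hp' := hp.out
  -- no reflection lies in `H` (its order `2` does not divide `p`)
  have hnosr : ∀ i : ZMod p, sr i ∉ H := fun i hi => by
    have h2 : 2 ∣ p := by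
      have := H.orderOf_dvd_natCard hi
      rwa [orderOf_sr, hH] at this
    have := (Nat.dvd_prime hp').mp h2
    omega
  -- hence `H ≤ ⟨x⟩ = zpowers (r 1)`, and both have order `p`
  have hle : H ≤ Subgroup.zpowers (r 1 : DihedralGroup p) := by
    intro x hx
    cases x with
    | r i =>
      rw [← ZMod.natCast_zmod_val i, ← r_one_pow]
      exact Subgroup.pow_mem _ (Subgroup.mem_zpowers _) _
    | sr i => exact absurd hx (hnosr i)
  have heq : H = Subgroup.zpowers (r 1 : DihedralGroup p) :=
    Subgroup.eq_of_le_of_card_ge hle (by rw [hH, Nat.card_zpowers, orderOf_r_one])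
  rw [heq, ← ZMod.natCast_zmod_val k, ← r_one_pow]
  exact Subgroup.pow_mem _ (Subgroup.mem_zpowers _) _

variable {H₁ H₂ H₃ : Subgroup (DihedralGroup p)}

/-- If `H₁ = D_{2p}` then `H₂ = H₃ = 1`. [cite: CohnUmans2003, Prop. 18 (proof)] -/
theorem card_eq_one_of_card₁ (h : SubgroupTPP H₁ H₂ H₃) (h1 : Nat.card H₁ = 2 * p) :
    Nat.card H₂ = 1 ∧ Nat.card H₃ = 1 := by
  haveI : NeZero p := ⟨hp.out.ne_zero⟩
  have htop : H₁ = ⊤ := Subgroup.eq_top_of_card_eq H₁ (by rw [h1, nat_card])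
  have hm : ∀ x, x ∈ H₁ := fun x => by rw [htop]; exact Subgroup.mem_top x
  have e2 : H₂ = ⊥ := (Subgroup.eq_bot_iff_forall _).mpr fun x hx => h.eq_one_of_mem₁₂ (hm x) hx
  have e3 : H₃ = ⊥ := (Subgroup.eq_bot_iff_forall _).mpr fun x hx => h.eq_one_of_mem₁₃ (hm x) hx
  exact ⟨by rw [e2, Subgroup.card_bot], by rw [e3, Subgroup.card_bot]⟩

/-- If `H₂ = D_{2p}` then `H₁ = H₃ = 1`. [cite: CohnUmans2003, Prop. 18 (proof)] -/
theorem card_eq_one_of_card₂ (h : SubgroupTPP H₁ H₂ H₃) (h2 : Nat.card H₂ = 2 * p) :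
    Nat.card H₁ = 1 ∧ Nat.card H₃ = 1 := by
  haveI : NeZero p := ⟨hp.out.ne_zero⟩
  have htop : H₂ = ⊤ := Subgroup.eq_top_of_card_eq H₂ (by rw [h2, nat_card])
  have hm : ∀ x, x ∈ H₂ := fun x => by rw [htop]; exact Subgroup.mem_top x
  have e1 : H₁ = ⊥ := (Subgroup.eq_bot_iff_forall _).mpr fun x hx => h.eq_one_of_mem₁₂ hx (hm x)
  have e3 : H₃ = ⊥ := (Subgroup.eq_bot_iff_forall _).mpr fun x hx => h.eq_one_of_mem₂₃ (hm x) hx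
  exact ⟨by rw [e1, Subgroup.card_bot], by rw [e3, Subgroup.card_bot]⟩

/-- If `H₃ = D_{2p}` then `H₁ = H₂ = 1`. [cite: CohnUmans2003, Prop. 18 (proof)] -/
theorem card_eq_one_of_card₃ (h : SubgroupTPP H₁ H₂ H₃) (h3 : Nat.card H₃ = 2 * p) :
    Nat.card H₁ = 1 ∧ Nat.card H₂ = 1 := by
  haveI : NeZero p := ⟨hp.out.ne_zero⟩
  have htop : H₃ = ⊤ := Subgroup.eq_top_of_card_eq H₃ (by rw [h3, nat_card])
  have hm : ∀ x, x ∈ H₃ := fun x => by rw [htop]; exact Subgroup.mem_top x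
  have e1 : H₁ = ⊥ := (Subgroup.eq_bot_iff_forall _).mpr fun x hx => h.eq_one_of_mem₁₃ hx (hm x)
  have e2 : H₂ = ⊥ := (Subgroup.eq_bot_iff_forall _).mpr fun x hx => h.eq_one_of_mem₂₃ hx (hm x)
  exact ⟨by rw [e1, Subgroup.card_bot], by rw [e2, Subgroup.card_bot]⟩

/-- Two of the three subgroups cannot both have order `p` (both would be `⟨x⟩`).
[cite: CohnUmans2003, Prop. 18 (proof)] -/
theorem not_card_eq_p_p₁₂ (hp3 : 3 < p) (h : SubgroupTPP H₁ H₂ H₃) (h1 : Nat.card H₁ = p)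
    (h2 : Nat.card H₂ = p) : False := by
  have h11 := h.eq_one_of_mem₁₂ (rotation_mem_of_card_eq hp3 h1 1) (rotation_mem_of_card_eq hp3 h2 1)
  rw [one_def] at h11
  have h10 : (1 : ZMod p) = 0 := r.inj h11
  haveI : Fact (1 < p) := ⟨by omega⟩
  exact one_ne_zero h10

/-- (orders `p, ·, p`). [cite: CohnUmans2003, Prop. 18 (proof)] -/
theorem not_card_eq_p_p₁₃ (hp3 : 3 < p) (h : SubgroupTPP H₁ H₂ H₃) (h1 : Nat.card H₁ = p)
    (h3 : Nat.card H₃ = p) : False := by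
  have h11 := h.eq_one_of_mem₁₃ (rotation_mem_of_card_eq hp3 h1 1) (rotation_mem_of_card_eq hp3 h3 1)
  rw [one_def] at h11
  have h10 : (1 : ZMod p) = 0 := r.inj h11
  haveI : Fact (1 < p) := ⟨by omega⟩
  exact one_ne_zero h10

/-- (orders `·, p, p`). [cite: CohnUmans2003, Prop. 18 (proof)] -/
theorem not_card_eq_p_p₂₃ (hp3 : 3 < p) (h : SubgroupTPP H₁ H₂ H₃) (h2 : Nat.card H₂ = p)
    (h3 : Nat.card H₃ = p) : False := by
  have h11 := h.eq_one_of_mem₂₃ (rotation_mem_of_card_eq hp3 h2 1) (rotation_mem_of_card_eq hp3 h3 1)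
  rw [one_def] at h11
  have h10 : (1 : ZMod p) = 0 := r.inj h11
  haveI : Fact (1 < p) := ⟨by omega⟩
  exact one_ne_zero h10

/-- Orders `(2, 2, p)` are impossible: `(yxⁱ)(yxʲ) · x^{i−j} = 1`. [cite: CohnUmans2003, Prop. 18 (proof)] -/
theorem no_two_two_p (hp3 : 3 < p) (h : SubgroupTPP H₁ H₂ H₃) (h1 : Nat.card H₁ = 2) (h2 : Nat.card H₂ = 2)
    (h3 : Nat.card H₃ = p) : False := by
  obtain ⟨i, hi⟩ := reflection_mem_of_card_eq_two hp3 h1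
  obtain ⟨j, hj⟩ := reflection_mem_of_card_eq_two hp3 h2
  have hk := rotation_mem_of_card_eq hp3 h3 (i - j)
  have := (h _ hi _ hj _ hk (by rw [sr_mul_sr, r_mul_r, sub_add_sub_cancel, sub_self, one_def])).1
  exact sr_ne_one i this

/-- Orders `(2, p, 2)` are impossible: `(yxⁱ) · x^{j−i} · (yxʲ) = 1`. [cite: CohnUmans2003, Prop. 18 (proof)] -/
theorem no_two_p_two (hp3 : 3 < p) (h : SubgroupTPP H₁ H₂ H₃) (h1 : Nat.card H₁ = 2) (h2 : Nat.card H₂ = p)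
    (h3 : Nat.card H₃ = 2) : False := by
  obtain ⟨i, hi⟩ := reflection_mem_of_card_eq_two hp3 h1
  obtain ⟨j, hj⟩ := reflection_mem_of_card_eq_two hp3 h3
  have hk := rotation_mem_of_card_eq hp3 h2 (j - i)
  have := (h _ hi _ hk _ hj (by rw [sr_mul_r, add_sub_cancel, sr_mul_sr, sub_self, one_def])).1
  exact sr_ne_one i this

/-- Orders `(p, 2, 2)` are impossible: `x^{i−j} · (yxⁱ)(yxʲ) = 1`. [cite: CohnUmans2003, Prop. 18 (proof)] -/
theorem no_p_two_two (hp3 : 3 < p) (h : SubgroupTPP H₁ H₂ H₃) (h1 : Nat.card H₁ = p) (h2 : Nat.card H₂ = 2)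
    (h3 : Nat.card H₃ = 2) : False := by
  obtain ⟨i, hi⟩ := reflection_mem_of_card_eq_two hp3 h2
  obtain ⟨j, hj⟩ := reflection_mem_of_card_eq_two hp3 h3
  have hk := rotation_mem_of_card_eq hp3 h1 (i - j)
  have := (h _ hk _ hi _ hj (by rw [r_mul_sr, sub_sub_cancel, sr_mul_sr, sub_self, one_def])).2.1
  exact sr_ne_one i this

/-- **Cohn–Umans 2003, Prop. 18 (arXiv numbering; §7 "Direct products and the Sperner capacity"), second clause: for a
prime `p > 3`, no three subgroups of
`D_{2p}` prove `α(D_p) < 3`** — three subgroups with the triple product property have `|H₁||H₂||H₃| ≤ 2p = |D_{2p}|`.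
[cite: CohnUmans2003, Prop. 18 ("If m is a prime greater than 3, then no three subgroups prove α(D_m) < 3")] -/
theorem CohnUmans2003_prop18_subgroups (hp3 : 3 < p) (h : SubgroupTPP H₁ H₂ H₃) :
    Nat.card H₁ * Nat.card H₂ * Nat.card H₃ ≤ 2 * p := by
  have t1 := card_eq_one_of_card₁ (p := p) h
  have t2 := card_eq_one_of_card₂ (p := p) h
  have t3 := card_eq_one_of_card₃ (p := p) h
  have pp12 := not_card_eq_p_p₁₂ hp3 h
  have pp13 := not_card_eq_p_p₁₃ hp3 h
  have pp23 := not_card_eq_p_p₂₃ hp3 h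
  have c22p := no_two_two_p hp3 h
  have c2p2 := no_two_p_two hp3 h
  have cp22 := no_p_two_two hp3 h
  have d1 := card_subgroup_mem H₁
  have d2 := card_subgroup_mem H₂
  have d3 := card_subgroup_mem H₃
  -- pure arithmetic from here on: `a, b, c ∈ {1, 2, p, 2p}` with the exclusions above (`omega` uses `t1, t2, t3`;
  -- the `p, p` and `2, 2, p` patterns are closed by the corresponding lemma)
  generalize Nat.card H₁ = a at *
  generalize Nat.card H₂ = b at *
  generalize Nat.card H₃ = c at *
  rcases d1 with rfl | rfl | rfl | rfl <;> rcases d2 with rfl | rfl | rfl | rfl <;>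
    rcases d3 with rfl | rfl | rfl | rfl <;>
    first
      | omega
      | exact (c22p rfl rfl rfl).elim
      | exact (c2p2 rfl rfl rfl).elim
      | exact (cp22 rfl rfl rfl).elim
      | exact (pp12 rfl rfl).elim
      | exact (pp13 rfl rfl).elim
      | exact (pp23 rfl rfl).elim

/-- The same with the hypothesis stated through the tree's `TripleProductProperty` (CU03 Def. 2.1 / CKSU05 Def. 1.3)
of the three underlying finite sets. [cite: CohnUmans2003, Prop. 18 (second clause)] -/
theorem CohnUmans2003_prop18_subgroups' (hp3 : 3 < p) [DecidablePred (· ∈ H₁)] [DecidablePred (· ∈ H₂)]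
    [DecidablePred (· ∈ H₃)]
    (h : TripleProductProperty (univ.filter (· ∈ H₁)) (univ.filter (· ∈ H₂)) (univ.filter (· ∈ H₃))) :
    Nat.card H₁ * Nat.card H₂ * Nat.card H₃ ≤ 2 * p :=
  CohnUmans2003_prop18_subgroups hp3 (subgroupTPP_of_tripleProductProperty H₁ H₂ H₃ h)

/-- The printed exception `m = 3`: in `D_6 ≅ S₃` the three subgroups `⟨y⟩, ⟨yx⟩, ⟨yx²⟩` of order `2` DO satisfy the
triple product property (`2·2·2 = 8 > 6`, "three subgroups of order 2 prove `α(D_3) < 3`"; cf. the tree's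
`realizesTPP_perm_fin_three`). [cite: CohnUmans2003, Prop. 18 (proof: "except when m = 3")] -/
theorem subgroupTPP_dihedral_three :
    SubgroupTPP (Subgroup.zpowers (sr 0 : DihedralGroup 3)) (Subgroup.zpowers (sr 1 : DihedralGroup 3))
      (Subgroup.zpowers (sr 2 : DihedralGroup 3)) := by
  have hz : ∀ (i : ZMod 3) (a : DihedralGroup 3), a ∈ Subgroup.zpowers (sr i) → a = 1 ∨ a = sr i := by
    intro i a ha
    obtain ⟨k, rfl⟩ := Subgroup.mem_zpowers_iff.mp ha
    rcases Int.even_or_odd k with ⟨m, rfl⟩ | ⟨m, rfl⟩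
    · left
      rw [← two_mul, zpow_mul, zpow_ofNat, pow_two, sr_mul_sr, sub_self, ← one_def, one_zpow]
    · right
      rw [zpow_add, zpow_mul, zpow_ofNat, pow_two, sr_mul_sr, sub_self, ← one_def, one_zpow, one_mul, zpow_one]
  intro a ha b hb c hc habc
  rcases hz 0 a ha with rfl | rfl <;> rcases hz 1 b hb with rfl | rfl <;> rcases hz 2 c hc with rfl | rfl <;>
    revert habc <;> decide

end Dihedral

end DihedralSubgroups

end Literature.Computability.AlgebraicComplexity
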